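import Summits.BirchSwinnertonDyer.BirchSwinnertonDyer.Theorems.KimAtThreeFineKatoLevelCompatDef
import Literature.NumberTheory.GaloisRepresentations.ConjugationDescent
import Literature.NumberTheory.GaloisRepresentations.AbsIntegersEquiv
import HarnessLib

/-!
# The OTHER places above `p`: per-factor COMPAT and (C3b) for the TWISTED localisations
# `loc_w ∘ conjMap σ`, `σ ∈ Γ_ℚ` (crux `KatoKuriharaPortThreeShared`, stmt-BirchSwinnertonDyer-19560,
# stub `stub_definedKatoPackage` = hK; cell `bsd-addord`, seat w2-acc5 gen 4; route W2; `--supports 19560`)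

HONEST FRAMING. TOOL theorems only (no definition, no named fact, no `sorry`); closes nothing; nothing
is booked; BSD is not proved by any of this.  PRECISION on `LevelFieldLocalization` /
`KimAtThreeFineKatoLevelCompat*`: the tower localisation `loc_w^{tower}` at a field `F ⊇ ℚ_v` goes
through ONE decomposition group — its image lies in `U ⊓ D_{𝔓₀}`, `𝔓₀ = adicCompletionPrime ℚ v`
(`LevelFieldLocalization.absGaloisRestrictTower_mem_decompositionSubgroup`), for EVERY such `F`; so
for the `g = [ℚ(ζ_m) : ℚ]/f` DISTINCT places `w ∣ p` of the level field the localisations Kato's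
semi-local `exp*` needs are NOT `(loc_w^{tower})_w` over one model family, but the TWISTS
`loc^{tower} ∘ conjMap σ` by coset representatives `σ ∈ Γ_ℚ` (a level class `y ∈ H¹(U, T_pE)` is NOT
`Γ_ℚ`-invariant; `(σ · y)(g) = σ y(σ⁻¹ g σ)` restricted to `D_{𝔓₀}` is `y` at the prime `σ⁻¹ 𝔓₀`).
This file shows that everything proved for `loc^{tower}` holds for every twist, so a value datum
DEFINED as `Λ(y)_w := exp*_w (loc^{tower} (H1toInt (σ_w · y)))` — Kato's, for the right `σ_w` — enjoys
per-factor COMPAT and (C3b) by name: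

* `levelTorsion_conjMap` — a coefficient change `Ψ` computed on cocycles by `π_{j+1}` (hK's binder `hΨ`)
  COMMUTES with the `Γ_ℚ`-action: `Ψ (σ · y) = σ · Ψ y`;
* `resSubgroup_eq_levelMap_conjMap` — hence `res_U κ₀ = Ψ y ⇒ res_U κ₀ = Ψ (σ · y)` (global classes are
  `Γ_ℚ`-invariant on `H¹(U, ·)`, `ConjugationDescent.conjMap_resSubgroup_one`);
* `exists_mem_sub_eq_zsmul_of_H1toInt_conjMap` — **per-factor COMPAT for the twisted definition**
  `e h − φ_F(loc^{tower}(H1toInt (σ · y))) ∈ p^{j+1} · M` (from (RES_w) alone);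
* `resLe_inf_stabilizer_conjMap_eq_zero` — the (C3b) binder «`res_{U ⊓ D_𝔓} y = 0` for all `𝔓 ∣ p`» is
  `Γ_ℚ`-stable (it passes to `σ · y`; `D_{σ⁻¹𝔓} = σ⁻¹ D_𝔓 σ`, `primesAbove` is `Γ_ℚ`-stable), hence
  `locTower_H1toInt_conjMap_eq_zero_of_forall_primesAbove` — **(C3b) for the twisted definition**.

References: K. Kato, Astérisque 295 (2004) §9.4 [Kato2004Asterisque]; J.-P. Serre, *Local Fields* (1979)
VII §5 (the `G/H`-action on `H¹(H, A)`) [SerreLocalFields1979]; *Galois Cohomology* (1997) I §2.4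
[SerreGaloisCohomology1997]; C.-H. Kim, AJM 148 (2026) §3.4.1 [Kim2022StructureSelmer].
-/

noncomputable section

-- the cell's Theorems namespace `Summit.BirchSwinnertonDyer.BirchSwinnertonDyer.…` repeats the summit name by design (D-0017)
set_option linter.dupNamespace false

open scoped Classical NumberField ContRepresentation TensorProduct Pointwise
open Field NumberField IsDedekindDomain
open WeierstrassCurve Literature.NumberTheory.EllipticCurves Literature.NumberTheory.GaloisRepresentations
  Literature.NumberTheory.GaloisRepresentations.DiscreteGaloisModule
  Literature.NumberTheory.EllipticCurves.Kato2004.EulerSystemValues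
open Summit.BirchSwinnertonDyer.Rank1Residual.GaloisImage
open Summit.BirchSwinnertonDyer.BirchSwinnertonDyer.Theorems.KimAtThreeFineKatoLevelExactness
open Summit.BirchSwinnertonDyer.BirchSwinnertonDyer.Theorems.KimAtThreeFineKatoLevelCompat
open Summit.BirchSwinnertonDyer.BirchSwinnertonDyer.Theorems.KimAtThreeFineKatoLevelCompatFactor
open Summit.BirchSwinnertonDyer.BirchSwinnertonDyer.Theorems.KimAtThreeFineKatoLevelCompatDef

namespace Summit.BirchSwinnertonDyer.BirchSwinnertonDyer.Theorems.KimAtThreeFineKatoLevelCompatTwist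

/-! ## §1. The (C3b) binder is `Γ`-stable (any number field, any topological module) -/

section Stable

variable {K : Type} [Field K] {R : Type*} [CommRing R] [TopologicalSpace R]
  (X : TopRep.{0} R (absoluteGaloisGroup K)) (U : Subgroup (absoluteGaloisGroup K)) [U.Normal]
  (v : HeightOneSpectrum (𝓞 K))

set_option maxHeartbeats 400000 in
/-- **The (C3b) binder is `Γ_K`-stable**: if a level class `y ∈ H¹(U, X)` dies on `U ⊓ D_𝔓` for EVERY
prime `𝔓` above `v`, so does `σ · y` for every `σ ∈ Γ_K` (on cocycles: `y = ∂t` on `U ⊓ D_{σ⁻¹𝔓}` gives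
`σ · y = ∂(σ t)` on `U ⊓ D_𝔓`; `D_{σ⁻¹𝔓} = σ⁻¹ D_𝔓 σ` and `σ⁻¹ 𝔓` is again above `v`).
[cite: SerreLocalFields1979, VII §5 Prop. 3] -/
theorem resLe_inf_stabilizer_conjMap_eq_zero (y : continuousCohomology 1 (subgroupRep X U))
    (hy : ∀ 𝔓 ∈ v.primesAbove,
      resLe X (inf_le_left : U ⊓ MulAction.stabilizer (absoluteGaloisGroup K) 𝔓 ≤ U) 1 y = 0)
    (σ : absoluteGaloisGroup K) (𝔓 : Ideal (absIntegers (𝓞 K) K)) (h𝔓 : 𝔓 ∈ v.primesAbove) :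
    resLe X (inf_le_left : U ⊓ MulAction.stabilizer (absoluteGaloisGroup K) 𝔓 ≤ U) 1
      (conjMap X U σ 1 y) = 0 := by
  obtain ⟨f, rfl⟩ := oneCocycleClass_surjective (subgroupRep X U) y
  -- `y` is a coboundary on `U ⊓ D_{σ⁻¹ 𝔓}`
  have h' := hy (σ⁻¹ • 𝔓) (smul_mem_primesAbove h𝔓 σ⁻¹)
  rw [resLe_oneCocycleClass, oneCocycleClass_eq_zero_iff] at h'
  obtain ⟨t, ht⟩ := h'
  rw [conjMap_oneCocycleClass, resLe_oneCocycleClass, oneCocycleClass_eq_zero_iff]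
  refine ⟨X.ρ σ t, fun x => ?_⟩
  have hxU : σ⁻¹ * (x : absoluteGaloisGroup K) * σ ∈ U := by
    simpa using ‹U.Normal›.conj_mem _ x.2.1 σ⁻¹
  have hxS : σ⁻¹ * (x : absoluteGaloisGroup K) * σ ∈
      MulAction.stabilizer (absoluteGaloisGroup K) (σ⁻¹ • 𝔓) := by
    rw [MulAction.mem_stabilizer_iff, mul_smul, mul_smul, smul_inv_smul,
      MulAction.mem_stabilizer_iff.mp x.2.2]
  have h2 : f.1 (Literature.NumberTheory.EllipticCurves.subgroupConj U σ
      (Literature.NumberTheory.EllipticCurves.subgroupInclusion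
        (inf_le_left : U ⊓ MulAction.stabilizer (absoluteGaloisGroup K) 𝔓 ≤ U) x)) =
      X.ρ (σ⁻¹ * (x : absoluteGaloisGroup K) * σ) t - t :=
    ht ⟨σ⁻¹ * (x : absoluteGaloisGroup K) * σ, hxU, hxS⟩
  change X.ρ σ (f.1 (Literature.NumberTheory.EllipticCurves.subgroupConj U σ
      (Literature.NumberTheory.EllipticCurves.subgroupInclusion
        (inf_le_left : U ⊓ MulAction.stabilizer (absoluteGaloisGroup K) 𝔓 ≤ U) x))) =
    X.ρ ((x : absoluteGaloisGroup K)) (X.ρ σ t) - X.ρ σ t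
  rw [h2, map_sub, ← ρ_mul_apply, ← ρ_mul_apply,
    show σ * (σ⁻¹ * (x : absoluteGaloisGroup K) * σ) = (x : absoluteGaloisGroup K) * σ by group]

end Stable

/-! ## §2. `Ψ` commutes with the `Γ_ℚ`-action; twisted per-factor COMPAT and (C3b) -/

section Twist

variable (W : WeierstrassCurve ℚ) [W.IsElliptic] (p : ℕ) [hp : Fact p.Prime]
  [ContinuousSMul ℤ_[p] (W.tateModule p)] (j k : ℕ) (r : Finset (HeightOneSpectrum (𝓞 ℚ)))
  (v : HeightOneSpectrum (𝓞 ℚ)) (F : Type) [Field F] [Algebra (Place.Completion (Sum.inr v)) F]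

/-- **A coefficient change computed on cocycles by `π_{j+1}` commutes with the `Γ_ℚ`-action**:
`Ψ (σ · y) = σ · Ψ y` (both are `[g ↦ π_{j+1}(σ · φ'(σ⁻¹ g σ))]`, `π_{j+1}` being `Γ_ℚ`-equivariant).
[cite: SerreLocalFields1979, VII §5] -/
theorem levelTorsion_conjMap
    (Ψ : H1 (tateRep W p) (cycSubgroup p k r) →+
        continuousCohomology 1 (subgroupRep
          (W.torsionGaloisModule ((p : ℤ) ^ j * (p : ℤ))).toTopRep (cycSubgroup p k r)))
    (hΨ : ∀ (φ' : contOneCocycles (subgroupRep (tateRep W p).toTopRep (cycSubgroup p k r)))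
        (ψ : contOneCocycles (subgroupRep
          (W.torsionGaloisModule ((p : ℤ) ^ j * (p : ℤ))).toTopRep (cycSubgroup p k r))),
        (∀ g, ((ψ.1 g : geomTorsion W ((p : ℤ) ^ j * (p : ℤ))) : geomPoints W) =
          TateModule.proj p (j + 1) (φ'.1 g)) →
        Ψ (oneCocycleClass _ φ') = oneCocycleClass _ ψ)
    (σ : absoluteGaloisGroup ℚ) (y : H1 (tateRep W p) (cycSubgroup p k r)) :
    Ψ (conjMap (tateRep W p).toTopRep (cycSubgroup p k r) σ 1 y) =
      conjMap (W.torsionGaloisModule ((p : ℤ) ^ j * (p : ℤ))).toTopRep (cycSubgroup p k r) σ 1 (Ψ y) := by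
  obtain ⟨φ', rfl⟩ :=
    oneCocycleClass_surjective (subgroupRep (tateRep W p).toTopRep (cycSubgroup p k r)) y
  obtain ⟨ψ, hψ⟩ := exists_level_pushCocycle W p j (cycSubgroup p k r) φ'
  have hΨy : Ψ (oneCocycleClass _ φ') = oneCocycleClass _ ψ :=
    hΨ φ' ψ fun g => by rw [hψ g, coe_tateToTorsion_apply]
  rw [hΨy, conjMap_oneCocycleClass, conjMap_oneCocycleClass]
  refine hΨ _ _ fun g => ?_
  rw [conj_pullback_apply, conj_pullback_apply, hψ]
  rfl

/-- **`res_U κ₀ = Ψ y ⟹ res_U κ₀ = Ψ (σ · y)`** for every `σ ∈ Γ_ℚ`: global classes are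
`Γ_ℚ`-invariant on `H¹(U, ·)` (`conjMap_resSubgroup_one`) and `Ψ` commutes with the action.
[cite: SerreLocalFields1979, VII §5 Prop. 3] -/
theorem resSubgroup_eq_levelMap_conjMap
    (Ψ : H1 (tateRep W p) (cycSubgroup p k r) →+
        continuousCohomology 1 (subgroupRep
          (W.torsionGaloisModule ((p : ℤ) ^ j * (p : ℤ))).toTopRep (cycSubgroup p k r)))
    (hΨ : ∀ (φ' : contOneCocycles (subgroupRep (tateRep W p).toTopRep (cycSubgroup p k r)))
        (ψ : contOneCocycles (subgroupRep
          (W.torsionGaloisModule ((p : ℤ) ^ j * (p : ℤ))).toTopRep (cycSubgroup p k r))),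
        (∀ g, ((ψ.1 g : geomTorsion W ((p : ℤ) ^ j * (p : ℤ))) : geomPoints W) =
          TateModule.proj p (j + 1) (φ'.1 g)) →
        Ψ (oneCocycleClass _ φ') = oneCocycleClass _ ψ)
    (σ : absoluteGaloisGroup ℚ) (y : H1 (tateRep W p) (cycSubgroup p k r))
    (κ₀ : galoisCohomology (W.torsionGaloisModule ((p : ℤ) ^ j * (p : ℤ))) 1)
    (hresκ : resSubgroup (W.torsionGaloisModule ((p : ℤ) ^ j * (p : ℤ))).toTopRep (cycSubgroup p k r) 1 κ₀ =
      Ψ y) :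
    resSubgroup (W.torsionGaloisModule ((p : ℤ) ^ j * (p : ℤ))).toTopRep (cycSubgroup p k r) 1 κ₀ =
      Ψ (conjMap (tateRep W p).toTopRep (cycSubgroup p k r) σ 1 y) := by
  rw [levelTorsion_conjMap W p j k r Ψ hΨ σ y, ← hresκ, conjMap_resSubgroup_one]

/-- **Per-factor COMPAT for the TWISTED definition `Λ_w := φ_F ∘ loc^{tower} ∘ H1toInt ∘ (σ · )`**
(the localisation at the prime `σ⁻¹ 𝔓₀`, i.e. at another place of the level field above `p`): from
(RES_w) alone, `∃ μ ∈ M, e h − φ_F(loc^{tower}(H1toInt (σ · y))) = p^{j+1} · μ`.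
[cite: Kim2022StructureSelmer, §3.4.1 and the proof of Thm. 3.13 (arXiv v3 pp. 26–27)] -/
theorem exists_mem_sub_eq_zsmul_of_H1toInt_conjMap
    (hU : ∀ τ, absGaloisRestrictTower ℚ (Place.Completion (Sum.inr v)) F τ ∈ cycSubgroup p k r)
    {V : Type} [AddCommGroup V]
    (φF : ((tateLocalRep W p (Sum.inr v)).restrict
      (absGaloisRestrict (Place.Completion (Sum.inr v)) F)).cohomology 1 →+ V)
    (e : (tateLocalRep W p (Sum.inr v)).cohomology 1 →+ V)
    (M : AddSubgroup V) (hM : ∀ z, φF z ∈ M)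
    (hres : ∀ h : (tateLocalRep W p (Sum.inr v)).cohomology 1,
      φF (ContinuousRep.cohomologyRes (tateLocalRep W p (Sum.inr v))
        (absGaloisRestrict (Place.Completion (Sum.inr v)) F) 1 h) = e h)
    (Ψ : H1 (tateRep W p) (cycSubgroup p k r) →+
        continuousCohomology 1 (subgroupRep
          (W.torsionGaloisModule ((p : ℤ) ^ j * (p : ℤ))).toTopRep (cycSubgroup p k r)))
    (hΨ : ∀ (φ' : contOneCocycles (subgroupRep (tateRep W p).toTopRep (cycSubgroup p k r)))
        (ψ : contOneCocycles (subgroupRep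
          (W.torsionGaloisModule ((p : ℤ) ^ j * (p : ℤ))).toTopRep (cycSubgroup p k r))),
        (∀ g, ((ψ.1 g : geomTorsion W ((p : ℤ) ^ j * (p : ℤ))) : geomPoints W) =
          TateModule.proj p (j + 1) (φ'.1 g)) →
        Ψ (oneCocycleClass _ φ') = oneCocycleClass _ ψ)
    (σ : absoluteGaloisGroup ℚ) (y : H1 (tateRep W p) (cycSubgroup p k r))
    (κ₀ : galoisCohomology (W.torsionGaloisModule ((p : ℤ) ^ j * (p : ℤ))) 1)
    (h : (tateLocalRep W p (Sum.inr v)).cohomology 1)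
    (hresκ : resSubgroup (W.torsionGaloisModule ((p : ℤ) ^ j * (p : ℤ))).toTopRep (cycSubgroup p k r) 1 κ₀ =
      Ψ y)
    (hloc : galoisCohomology.localization (W.torsionGaloisModule ((p : ℤ) ^ j * (p : ℤ))) (Sum.inr v) 1 κ₀ =
      tateLocalMap W p j (Sum.inr v) h) :
    ∃ μ ∈ M, e h - φF (locTower ℚ (Place.Completion (Sum.inr v)) F (tateRep W p).toIntRep.toTopRep
        (cycSubgroup p k r) hU 1 (((tateRep W p).level (cycSubgroup p k r)).H1toInt
          (conjMap (tateRep W p).toTopRep (cycSubgroup p k r) σ 1 y))) =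
      ((p : ℤ) ^ (j + 1)) • μ :=
  exists_mem_sub_eq_zsmul_of_H1toInt W p j k r v F hU φF e M hM hres Ψ hΨ _ κ₀ h
    (resSubgroup_eq_levelMap_conjMap W p j k r Ψ hΨ σ y κ₀ hresκ) hloc

/-- **(C3b) for the TWISTED definition**: if `y` dies on every `U ⊓ D_𝔓`, `𝔓 ∣ p` (ZetaBody (C3b)'s
binder verbatim), then `loc^{tower}(H1toInt (σ · y)) = 0` for every `σ ∈ Γ_ℚ` and every `F ⊇ ℚ_v` whose
tower restriction lands in `U`. [cite: Kato2004Asterisque, §9.4 (exp* is a map on the semi-local cohomology at p)] -/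
theorem locTower_H1toInt_conjMap_eq_zero_of_forall_primesAbove
    (hU : ∀ τ, absGaloisRestrictTower ℚ (Place.Completion (Sum.inr v)) F τ ∈ cycSubgroup p k r)
    (y : H1 (tateRep W p) (cycSubgroup p k r))
    (hy : ∀ 𝔓 ∈ v.primesAbove, resLe (tateRep W p).toTopRep
      (inf_le_left : cycSubgroup p k r ⊓ MulAction.stabilizer (absoluteGaloisGroup ℚ) 𝔓 ≤
        cycSubgroup p k r) 1 y = 0)
    (σ : absoluteGaloisGroup ℚ) :
    locTower ℚ (Place.Completion (Sum.inr v)) F (tateRep W p).toIntRep.toTopRep (cycSubgroup p k r) hU 1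
        (((tateRep W p).level (cycSubgroup p k r)).H1toInt
          (conjMap (tateRep W p).toTopRep (cycSubgroup p k r) σ 1 y)) = 0 :=
  locTower_H1toInt_eq_zero_of_forall_primesAbove W p k r v F hU _
    (fun 𝔓 h𝔓 => resLe_inf_stabilizer_conjMap_eq_zero (tateRep W p).toTopRep (cycSubgroup p k r) v y hy σ 𝔓 h𝔓)

end Twist

end Summit.BirchSwinnertonDyer.BirchSwinnertonDyer.Theorems.KimAtThreeFineKatoLevelCompatTwist

end
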